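import Mathlib
import HarnessLib
import HarnessLib.Audit
import Summits.ResolutionOfSingularities.Statement
import Literature.AlgebraicGeometry.Motives.Varieties
import Literature.AlgebraicGeometry.Resolution.ComponentGluing
import Summits.ResolutionOfSingularities.ResolutionOfSingularities.Theorems.EquisingularLiftHypersurfacesSuffice
import HarnessLib.Audit.Status.Attr

/-!
Route: TeissierJung

# Route TeissierJung — Jung in characteristic p after Mourtada–Schober — reduce every hypersurface
to Teissier singularities by modifying the regular base, then resolve those by ghost-monomial toric
lifts

OPEN-QUESTION HARVEST (operator A). Printed programme: Mourtada–Schober, C. R. Math. 363 (2025) 799–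
= arXiv:2502.01239, p. 4: "Teissier singularities suggest to work on an analogue in characteristic p
of Jung's approach to resolution of singularities, where quasi-ordinary singularities are replaced
by Teissier singularities" (Def. 1.2/2.3: a Weierstrass hypersurface germ over K[[x_1..x_d]] is
TEISSIER iff the last component of the iterated minimal-polyhedron invariant kappa(pi) is infinity;
p. 8: equivalently presented as an OVERWEIGHT DEFORMATION of the prime binomial tower u_i -
(u_(i-1)^(n_i) - c_i x^(A_i) z^b u^b), weights v_1 < v_2 < ... in Q^d; Thm 3.2, announced: such
germs have simultaneous embedded TORIC resolutions along an equisingular lift over O_(C_p) whose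
generic fibre is quasi-ordinary — the "ghost monomials"). It suffices to show X = TeissierReduction
∧ TeissierResolve (the two halves of the printed Jung programme, typed over a scheme-level predicate
TF X' = "X' is integral, FINITE over a regular integral base S of finite type over k, and at every
closed point every analytic branch of X' carries a Mourtada–Schober presentation compatible with the
completed local ring of S", let-bound verbatim in both cruxes), together with the classical frame
shared verbatim with route EquisingularLift: HypersurfacesSuffice (stmt-15964),
DescentAlgclosedToPerfect (stmt-0550), DescentPerfectToAll (stmt-0549). TeissierReduction (crux 2,
the printed open step = Jung's reduction): every integral projective hypersurface H over an
algebraically closed field of characteristic p admits a proper birational X' -> H with TF X'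
(reached by generic finite projection H -> P^d and modifications of the REGULAR base, Piltant2003's
"blow up only the base"). TeissierResolve (crux 3): TF X' => X' has a resolution (Mourtada–Schober
Thm 3.2 branch by branch, algebraised and glued). No card is realised (printed-question route);
cards citing the source keep Jung's DISCRIMINANT class instead (wild-jung-ramification-hahn, routed
to CleanCovers; automatic-wild-puiseux, retired).
Lean: `TeissierReduction ∧ TeissierResolve ∧ HypersurfacesSuffice ∧ DescentAlgclosedToPerfect ∧
DescentPerfectToAll`

## Assembly
Pure logic plus ONE proved tree lemma (Sketch.lean = glue.lean: lean check rc 0, 0 sorries, `closes`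
axioms propext · Classical.choice · Quot.sound): unfold `ResolutionOfSingularities_iff`, fix p
prime; DescentPerfectToAll p and DescentAlgclosedToPerfect p reduce to reduced separated finite-type
X over ALGEBRAICALLY CLOSED k; HypersurfacesSuffice k reduces to integral hypersurfaces H ⊆ P^m_k;
TeissierReduction gives X' -> H proper birational with TF X'; TeissierResolve gives HasResolution
X'; `Literature.AlgebraicGeometry.Resolution.ComponentGluing.Scheme.HasResolution.of_isBirational`
(proper birational maps transport resolutions, PROVED, narrow-import module) gives HasResolution H.
The predicate TF is let-bound with byte-identical text in both cruxes, so the chain type-checks by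
zeta-reduction; the route file needs Mathlib, the Statement,
Literature.AlgebraicGeometry.Motives.Varieties (projectiveSpace) and ComponentGluing (no unproved
named fact enters the cone).

Rationale: WHY THIS LINE. Jung's method is the one classical architecture that never differentiates: project
the hypersurface finitely onto a regular base of the SAME dimension d, modify the base until the
pulled-back germs are combinatorial, resolve those torically and patch (Jung 1908, Walker, Lipman,
Gonzalezperez2003 for quasi-ordinary germs; survey in MourtadaSchober2025 §1). In characteristic p
its terminal class breaks twice — the discriminant condition no longer yields fractional-power roots
(Literature.Barriers.ResolutionOfSingularities.ArtinSchreierPuiseux) and the discriminant-snc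
singularities carry "hundreds of pages" of Cossart–Piltant (MourtadaSchober2025 p. 3) — and
Piltant2003 could settle only the valuative surface case with toric endpoint. MourtadaSchober2025
(with MourtadaSchober2015 for the invariant kappa) change the TERMINAL CLASS: Teissier germs are cut
out by iterated minimal characteristic polyhedra having one vertex at every stage (objects the tree
already owns: Literature.AlgebraicGeometry.Resolution.CossartPiltant.IsVertexFor / IsSolvableVertex
/ IsMinimal), include purely inseparable germs (z^2 - x^3 in char 2 is Teissier but not
quasi-ordinary, ibid. Ex. 2.4), and are resolved by a theorem-shaped endgame (the O_(C_p)-lift of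
the presentation is equisingular with quasi-ordinary generic fibre; toric embedded resolution
independent of t). Imported areas: toric/tropical geometry of overweight deformations
(Teissier2014), key-polynomial towers (the u_i are approximate roots), p-adic lifting restricted to
a class where it is a theorem. What no listed route does: RadicialJung reaches a log-clean normal
form only for HEIGHT-ONE RADICIAL covers and needs the Abramovich–Oort conjecture (Pialt) to get
there; CleanCovers targets ramification-CLEANLINESS of Kedlaya covers and log-regularity;
EquisingularLift lifts EVERY hypersurface. Here the cover is an arbitrary-degree Weierstrass
hypersurface over its generic projection (no alteration, no Pialt), the target is polyhedral, and
lifting is confined to the terminal class.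

RANKED CRUXES. #2 TeissierReduction (crux) — JUNG REDUCTION TO THE TEISSIER CLASS (the printed
programme's open step, MourtadaSchober2025 p. 4): for every prime p, every algebraically closed k of
char p and every integral hypersurface H ⊆ P^m_k (closed, locally principal ideal), there are a
scheme X' and a proper birational X' -> H such that TF X': X' is integral and FINITE over a regular
integral separated finite-type k-scheme S, and for every closed point x and every minimal prime P of
the completed local ring B̂ = (O_(X',x))^, the branch B̂/P is ring-isomorphic to
k[[x_1..x_d]][z,u_1..u_(g-1)]/(E_1..E_g), compatibly with an isomorphism (O_(S,pi x))^ ≅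
k[[x_1..x_d]] and the stalk map, where E_i = u_i - (u_(i-1)^(n_i) - c_i x^(A_i)(z,u)^(mu_i) + h_i)
(u_0 = z; the last equation has no new variable), n_i >= 2, c_i ≠ 0, vector weights v_i ∈ Q^d_(>=0)
with n_i v_i = A_i + Σ mu·v (homogeneity), v_(i+1) > n_i v_i in the product order, every monomial of
h_i of weight > n_i v_i (overweight), the binomial ideal prime (toric special fibre) — the
structural form of a Teissier singularity (ibid. p. 8). [difficulty: open-problem] (why it might
fail: re-minimising the polyhedron after translations at new points of the base's exceptional
divisor is the kangaroo regime (HauserPerlega2019); for degrees p^e, e>=2, Moh-type bounds fail, so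
base-only blow-ups may never make every branch Teissier already for fourfold germs z^9+F (p=3).)
[MourtadaSchober2025, MourtadaSchober2015, Piltant2003, Hironaka1967, CossartPiltant2019,
HauserPerlega2019, Giraud1983]
#3 TeissierResolve (crux) — TEISSIER-PRESENTED SCHEMES ARE RESOLVABLE (MourtadaSchober2025 Prop. 3.1
+ Thm 3.2, announced as the main result of their [MS1] in preparation, globalised): for every prime
p and algebraically closed k of char p, every X' with TF X' (as in TeissierReduction, verbatim) has
a resolution of singularities — branch by branch the presentation lifts to O_(C_p) with
quasi-ordinary generic fibre and a t-independent fan gives a simultaneous embedded toric resolution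
(ghost monomials); these formal, presentation-dependent local resolutions must be algebraised and
glued along the finite map to S. [deps: TeissierReduction] [difficulty: L] (why it might fail: Thm
3.2 is announced, not published ([MS1] in prep.); its toric resolutions are formal-local and depend
on the minimising coordinates, and no canonical (hence gluable) resolution of Teissier — or even of
char-0 quasi-ordinary germs in dim >= 3 by toric means — is in print.) [MourtadaSchober2025,
Gonzalezperez2003, Teissier2014, MourtadaSchober2015]
#4 HypersurfacesSuffice (crux) — HYPERSURFACES SUFFICE (shared verbatim with route EquisingularLift,
stmt-ResolutionOfSingularities-15964; k algebraically closed): resolution of every integral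
hypersurface H ⊆ P^m_k implies resolution of every reduced separated finite-type k-scheme
(components, Chow, projective closure, generic linear projection to a hypersurface, transfer through
the normal source). [difficulty: M] (why it might fail: only if mis-typed: classical (Hartshorne
I.4.9 generic projection + normalisation transfer + CossartPiltant2019 Prop 4.6); birationality of a
generic linear projection needs k(X)/k separably generated — true for k perfect.) [Hartshorne1977,
Kollar2007, CossartPiltant2019]
#5 DescentAlgclosedToPerfect (crux) — ALGEBRAICALLY CLOSED TO PERFECT (shared verbatim,
stmt-ResolutionOfSingularities-0550): for a prime p, resolution of all reduced separated finite-type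
schemes over all algebraically closed fields of char p implies the same over all perfect fields of
char p. [difficulty: L] (why it might fail: print gets kbar ⇒ perfect k only for Galois-EQUIVARIANT
resolutions (Kollar2007 Thm 3.36); from bare existence the Galois-symmetrised fibre product is
singular; false if some X over F_q has no Gal-stable resolution.) [Kollar2007,
Literature.Barriers.ResolutionOfSingularities.InseparableBaseChange]
#6 DescentPerfectToAll (crux) — PERFECT TO ALL FIELDS (shared verbatim,
stmt-ResolutionOfSingularities-0549): for a prime p, resolution over all perfect fields of char p
implies ResolutionInChar p. [difficulty: L] (why it might fail: regular is not geometrically regular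
under inseparable ground-field extension (EGA IV 6.7.4); spreading out needs k/K0 separable,
impossible beyond the p-rank (MacLane; k = F_p((t))).) [arXiv:math/0703678, CossartPiltant2019,
Literature.Barriers.ResolutionOfSingularities.InseparableBaseChange]

TWO-LAYER PLAN. Foreseen glued splits (nothing filed now): TeissierReduction ⇐ JungModel (classical:
H finite over P^d by generic projection, X₀ = H) → TeissierByBaseModification (from ANY finite model
over a regular base reach a Teissier-presented model) → TeissierReduction (birth skeleton
bc/TeissierReduction_birth.lean, rc 0, sorries = 2 = stubs); later TeissierByBaseModification ⇐
StageOnePresentation (one non-solvable vertex of the minimal CossartPiltant polyhedron at every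
closed point, via principalisation of the weighted coefficient ideal on the base) → TowerInduction
(induction on the number g of characteristic exponents). TeissierResolve ⇐ LocalResolution (MS Thm
3.2 algebraised, branchwise) → LocalToGlobal (Zariski-local resolutions of a finite-over-regular X'
glue) → TeissierResolve (bc/TeissierResolve_birth.lean, rc 0, sorries = 2).

KILL CRITERIA. A surface counterexample to TeissierReduction (d = 2: some f ∈ k[[x_1,x_2]][z], e.g.
an Artin–Schreier or two-step defect tower germ, for which no modification of the base and no finite
model makes every branch Teissier-presented) closes the route `refuted:TeissierReduction` —
resolution of surfaces is known, so the refutation is about the CLASS, cheap and decisive. A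
published [MS1] whose Thm 3.2 needs hypotheses beyond the p. 8 presentation forces a restate of TF
(misstated), not a pivot. A counterexample to gluing (two Teissier points of one X' whose toric
resolutions cannot be completed to a common modification) kills TeissierResolve as typed ⇒ pivot to
a canonical-resolution variant of the terminal class. CoverResolution (CleanCovers) or
CleanModels+Pialt (RadicialJung) proved elsewhere moots the route (supersede).

NOT DECOMPOSED YET. The stage-wise statements of the reduction (one-vertex / non-solvable-vertex
persistence under base blow-ups; comparability of exponent sets after principalisation; the passage
from stage i to stage i+1 through the approximate root u_i), the algebraisation of formal
presentations (Artin approximation for the overweight conditions), the separable/inseparable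
dichotomy of the projection, and the local-to-global gluing lemma are layer-2 children; constants
(Moh-type bounds per stage) are deliberately not fixed.

CHEAPEST FALSIFIER. Dimension two, by computer algebra (kit, Singular/Macaulay2-style polyhedron
computations) or by hand: take Chevalley-type f = z^p − x_1^(p−1) x_2^(p−1) z − (x_1 + x_2) and the
Cutkosky–Piltant two-step Artin–Schreier tower germs over k[[x_1,x_2]], follow point blow-ups of the
BASE through all charts and translations, and test whether every branch acquires a Mourtada–Schober
presentation (one-vertex minimal polyhedra at every stage) after finitely many steps; Piltant2003
Thms 5.3/6.5/7.1 (toric endpoint for defectless / non-p-divisible / degree-p cases) predict yes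
outside the rational non-discrete defect case, which is exactly where to look. Not run this session
(no polyhedron code in the folder; local search daemon down).

NUMBERS. Terminal-class data: kappa(pi) ∈ (Q^d_(>=0))^g × {−1, ∞} (MourtadaSchober2015 Thm 1.1 =
quasi-ordinary iff last component ∞, char 0); degrees n = n_1 e_1, e_(i−1) = n_i e_i, e_g = 1, n_i
>= 2 (MourtadaSchober2025 §2); Example 3.3: p = 2, f = (z^2 − x_1^3 x_2^6)^4 − x_1^15 x_2^30, kappa
= ((3/2,3),(15/4,15/2),(63/8,63/4)), ghost monomial x_1^12 x_2^24 z^2. Known cases of the valuative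
Jung property in char p (toric endpoint, d = 2): finitely generated value group, defectless, degree
p (Piltant2003 Thms 5.3, 6.5, 7.1). Items at open: 6 (5 cruxes + assembly); closes binders: 5 (3
shared).

DEFINITION REQUESTS. None blocking: the Teissier presentation is typed inline (AdicCompletion of
stalks, MvPowerSeries/MvPolynomial quotient, minimalPrimes); a Literature definition
`TeissierPresentation` (topic Literature/AlgebraicGeometry/Resolution) factoring the let-bound
predicate TF out of both cruxes would be welcome hygiene and is requested after open; the
kappa-invariant itself (MourtadaSchober2015 §3, MourtadaSchober2025 §2: iterated minimal weighted
characteristic polyhedra over the tree's CossartPiltant.IsMinimal) is a second, larger definition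
request for the layer-2 children.

Novelty: Searches (2026-08-17): `lit frontier ResolutionOfSingularities --since 2023/2024` (200 rows; read
arXiv:2602.06553, 2606.11443, 2510.05765, 2602.01191); `lit search --source zbmath "resolution of
singularities positive characteristic" --year-from 2024` (38 rows: found MourtadaSchober2025 =
arXiv:2502.01239, Hauser–Perlega PRIMS 2024, Posva 2405.05735, Abramovich–Schober 2208.08951,
Wlodarczyk 2203.03090, Bérczi 2602.06553); `lit search --source zbmath "asymptotic Samuel function"`
(BBE 2506.14993 read); `lit citing arxiv:2502.01239` (0); zbMATH "Mourtada Schober quasi-ordinary"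
(2: 1512.07507, 2502.01239 — [MS1] not out); `lit read doi:10.5802/aif.1978` (Piltant2003 pp.
1237–9); `lit galaxy search "kangaroo point"/"resolution of singularities in positive
characteristic" --star all` (no relevant hits); `lit vsearch` (books only); grep of all 184 idea
cards and 28 theses for 2502.01239 / Teissier singularit (5 cards cite it, none realises the
programme; no thesis). Local searchd down all session (ConnectionResetError), OpenAlex budget
exhausted — recorded in NOTES.
Nearest prior art found: MourtadaSchober2025 (the printed programme itself: terminal class +
announced resolution of it, no reduction step); Piltant2003 (valuative Jung property in char p for
SURFACES with toric endpoint, Thms 5.3/6.5/7.1, the general case left open p. 1239);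
Gonzalezperez2003 (toric embedded resolution of quasi-ordinary hypersurfaces, char 0); in the
ledger: RadicialJung (Giraud's Jung condition for  [refs: 10.5802/aif.1978`, 2602.06553, 2502.01239, arxiv:2502.01239, doi:10.5802/aif.1978, MourtadaSchober2025, Piltant2003, Gonzalezperez2003]

Barriers (technique_class: jung-projection, char-polyhedron, terminal-class-lift): - technique_class: jung-projection, char-polyhedron, terminal-class-lift
- Literature.Barriers.ResolutionOfSingularities.ArtinSchreierPuiseuxNarrow: evaded by construction —
no fractional-power (Puiseux/Abhyankar–Jung) roots are ever taken; the terminal class is defined by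
polyhedra and approximate roots u_i, and contains Chevalley-type wild germs only after base
modification (MourtadaSchober2025 p. 3 is exactly the diagnosis of this barrier).
- Literature.Barriers.ResolutionOfSingularities.Cutkosky2014: not triggered — the route never
asserts that X' -> S (or any extension of function fields) becomes a monomial inclusion of regular
local rings along a valuation (IsMonomialExtension); a Teissier presentation is an overweight
complete intersection over k[[x]], and TeissierResolve resolves X' without monomialising the map.
- Literature.Barriers.ResolutionOfSingularities.Cutkosky2014Narrow: same — no weak local
monomialization is claimed anywhere in the cone.
- Literature.Barriers.ResolutionOfSingularities.Hauser2003_kangarooShadeIncrease: it bites the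
reduction step partially — after a base blow-up, translations at new points of the exceptional
divisor create p-th powers that re-minimisation (vertex dissolution) must remove; the bet is that
(a) only the REGULAR BASE is blown up (no residual order of a coefficient ideal on a hypersurface of
weak maximal contact is ever formed), and (b) the later stages of the kappa-tower (the variables
u_i) absorb what order-type invariants must

History (route lifecycle, newest last):
- 2026-08-25T13:16:57Z · DORMANT — reconciler: no traction for 7.7 d (last activity item-evidence-added at 2026-08-17T19:15:45Z); parked, not closed — `ledger route dormant route-ResolutionOfSing (operator:999:1473589)
- 2026-08-26T17:02:47Z · REACTIVATED — reconciler: reactivated — activity statement-claimed at 2026-08-26T16:25:04Z after parking at 2026-08-25T13:16:57Z (operator:999:3655339)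

sub-problem: ResolutionOfSingularities · status: open · opened planner-plan-novel-ResolutionOfSingularities-Re-dc19aa3a-a-v2-g16-0 2026-08-17T01:10:19Z · rev 2 · ledger route-ResolutionOfSingularities-TeissierJung
GENERATED by the gate from the ledger (D-0016/17). Provers cite these decls: `theorem foo : Summit.ResolutionOfSingularities.ResolutionOfSingularities.Theses.TeissierJung.<Decl> := …` in Summits/ResolutionOfSingularities/ResolutionOfSingularities/Theorems/<Name>.lean.
-/

namespace Summit.ResolutionOfSingularities.ResolutionOfSingularities.Theses.TeissierJung

open scoped BigOperators Topology Manifold Classical MeasureTheory ProbabilityTheory Matrix InnerProductSpace ComplexConjugate ContinuousMap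
open Filter Set Function TopologicalSpace MeasureTheory

attribute [summit_statement] _root_.ResolutionOfSingularities

/-- item stmt-ResolutionOfSingularities-17085 · crux · rank 2 · open · by planner
why it might fail: re-minimising the polyhedron after translations at new points of the base's exceptional divisor is the kangaroo regime (HauserPerlega2019); for degrees p^e, e>=2, Moh-type bounds fail, so base-only blow-ups may never make every branch Teissier already for fourfold germs z^9+F (p=3).
sources: MourtadaSchober2025, MourtadaSchober2015, Piltant2003, Hironaka1967, CossartPiltant2019, HauserPerlega2019
[crux] JUNG REDUCTION TO THE TEISSIER CLASS (the printed programme's open step, MourtadaSchober2025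
p. 4): for every prime p, every algebraically closed k of char p and every integral hypersurface H ⊆
P^m_k (closed, locally principal ideal), there are a scheme X' and a proper birational X' -> H such
that TF X': X' is integral and FINITE over a regular integral separated finite-type k-scheme S, and
for every closed point x and every minimal prime P of the completed local ring B̂ = (O_(X',x))^, the
branch B̂/P is ring-isomorphic to k[[x_1..x_d]][z,u_1..u_(g-1)]/(E_1..E_g), compatibly with an
isomorphism (O_(S,pi x))^ ≅ k[[x_1..x_d]] and the stalk map, where E_i = u_i - (u_(i-1)^(n_i) - c_i
x^(A_i)(z,u)^(mu_i) + h_i) (u_0 = z; the last equation has no new variable), n_i >= 2, c_i ≠ 0,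
vector weights v_i ∈ Q^d_(>=0) with n_i v_i = A_i + Σ mu·v (homogeneity), v_(i+1) > n_i v_i in the
product order, every monomial of h_i of weight > n_i v_i (overweight), the binomial ideal prime
(toric special fibre) — the structural form of a Teissier singularity (ibid. p. 8). [difficulty:
open-problem] -/
@[route_item "route-ResolutionOfSingularities-TeissierJung", crux]
def TeissierReduction : Prop :=
  ∀ p : ℕ, p.Prime → ∀ (k : Type) [Field k] [CharP k p] [IsAlgClosed k], let TF : AlgebraicGeometry.Scheme.{0} → Prop := fun X' => (∃ (S : AlgebraicGeometry.Scheme.{0}) (g : S ⟶ AlgebraicGeometry.Spec (.of k)) (π : X' ⟶ S), AlgebraicGeometry.IsSeparated g ∧ AlgebraicGeometry.LocallyOfFiniteType g ∧ AlgebraicGeometry.QuasiCompact g ∧ AlgebraicGeometry.IsIntegral S ∧ Literature.AlgebraicGeometry.Resolution.Scheme.IsRegular S ∧ AlgebraicGeometry.IsIntegral X' ∧ AlgebraicGeometry.IsFinite π ∧ ∀ x : X', IsClosed ({x} : Set X') → ∀ P ∈ minimalPrimes (AdicCompletion (IsLocalRing.maximalIdeal (X'.presheaf.stalk x)) (X'.presheaf.stalk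 x)), ∃ (d g : ℕ) (n : Fin g → ℕ) (v : Fin g → (Fin d → ℚ)) (c : Fin g → k) (A : Fin g → (Fin d →₀ ℕ)) (mu : Fin g → (Fin g →₀ ℕ)) (h : Fin g → MvPolynomial (Fin g) (MvPowerSeries (Fin d) k)) (φ : AdicCompletion (IsLocalRing.maximalIdeal (S.presheaf.stalk (π.base x))) (S.presheaf.stalk (π.base x)) ≃+* MvPowerSeries (Fin d) k), let W : (Fin d →₀ ℕ) → (Fin g →₀ ℕ) → (Fin d → ℚ) := fun a e j => (a j : ℚ) + ∑ i : Fin g, (e i : ℚ) * v i j; let core : Fin g → MvPolynomial (Fin g) (MvPowerSeries (Fin d) k) := fun i => MvPolynomial.X i ^ (n i) - MvPolynomial.C (MvPowerSeries.monomial (A i) (c i)) * MvPolynomial.monomial (mu i) 1 + h i; let E : Fin g → MvPolynomial (Fin g) (MvPowerSeries (Fin d) k) := fun i => if hi : i.val + 1 < g then MvPolynomial.X ⟨i.val + 1, hi⟩ - core i else core i; let B : Fin g → MvPolynomial (Fin d ⊕ Fin g) k := fun i => MvPolynomial.X (Sum.inr i) ^ (n i) - MvPolynomial.C (c i) * MvPolynomial.monomial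 ((A i).sumElim (mu i)) 1; ∃ ψ : (AdicCompletion (IsLocalRing.maximalIdeal (X'.presheaf.stalk x)) (X'.presheaf.stalk x) ⧸ P) ≃+* (MvPolynomial (Fin g) (MvPowerSeries (Fin d) k) ⧸ Ideal.span (Set.range E)), (∀ i, 2 ≤ n i) ∧ (∀ i, c i ≠ 0) ∧ (∀ i j, 0 ≤ v i j) ∧ (∀ i (j : Fin g), i.val ≤ j.val → mu i j = 0) ∧ (∀ i, n i • v i = W (A i) (mu i)) ∧ (∀ (i : Fin g) (hi : i.val + 1 < g), n i • v i ≤ v ⟨i.val + 1, hi⟩ ∧ n i • v i ≠ v ⟨i.val + 1, hi⟩) ∧ (∀ i, ∀ e ∈ (h i).support, (∀ j : Fin g, i.val + 1 < j.val → e j = 0) ∧ ∀ a : Fin d →₀ ℕ, MvPowerSeries.coeff a ((h i).coeff e) ≠ 0 → n i • v i ≤ W a e ∧ n i • v i ≠ W a e) ∧ (Ideal.span (Set.range B)).IsPrime ∧ (∀ a : S.presheaf.stalk (π.base x), ψ (Ideal.Quotient.mk P (algebraMap _ _ ((π.stalkMap x).hom a))) = Ideal.Quotient.mk _ (MvPolynomial.C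 (φ (algebraMap _ _ a))))); ∀ (m : ℕ) (H : AlgebraicGeometry.Scheme.{0}) (ι' : H ⟶ (Literature.AlgebraicGeometry.Motives.projectiveSpace m k).left), AlgebraicGeometry.IsClosedImmersion ι' → AlgebraicGeometry.IsIntegral H → (∀ y : (Literature.AlgebraicGeometry.Motives.projectiveSpace m k).left, ∃ U : (Literature.AlgebraicGeometry.Motives.projectiveSpace m k).left.affineOpens, y ∈ (U : (Literature.AlgebraicGeometry.Motives.projectiveSpace m k).left.Opens) ∧ (ι'.ker.ideal U).IsPrincipal) → ∃ (X' : AlgebraicGeometry.Scheme.{0}) (ρ : X' ⟶ H), AlgebraicGeometry.IsProper ρ ∧ Literature.AlgebraicGeometry.Resolution.IsBirational ρ ∧ TF X'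

/-- item stmt-ResolutionOfSingularities-17086 · crux · rank 3 · open · by planner
why it might fail: Thm 3.2 is announced, not published ([MS1] in prep.); its toric resolutions are formal-local and depend on the minimising coordinates, and no canonical (hence gluable) resolution of Teissier — or even of char-0 quasi-ordinary germs in dim >= 3 by toric means — is in print.
sources: MourtadaSchober2025, Gonzalezperez2003, Teissier2014, MourtadaSchober2015
[crux] TEISSIER-PRESENTED SCHEMES ARE RESOLVABLE (MourtadaSchober2025 Prop. 3.1 + Thm 3.2, announced
as the main result of their [MS1] in preparation, globalised): for every prime p and algebraically
closed k of char p, every X' with TF X' (as in TeissierReduction, verbatim) has a resolution of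
singularities — branch by branch the presentation lifts to O_(C_p) with quasi-ordinary generic fibre
and a t-independent fan gives a simultaneous embedded toric resolution (ghost monomials); these
formal, presentation-dependent local resolutions must be algebraised and glued along the finite map
to S. [deps: TeissierReduction] [difficulty: L] -/
@[route_item "route-ResolutionOfSingularities-TeissierJung", crux]
def TeissierResolve : Prop :=
  ∀ p : ℕ, p.Prime → ∀ (k : Type) [Field k] [CharP k p] [IsAlgClosed k], let TF : AlgebraicGeometry.Scheme.{0} → Prop := fun X' => (∃ (S : AlgebraicGeometry.Scheme.{0}) (g : S ⟶ AlgebraicGeometry.Spec (.of k)) (π : X' ⟶ S), AlgebraicGeometry.IsSeparated g ∧ AlgebraicGeometry.LocallyOfFiniteType g ∧ AlgebraicGeometry.QuasiCompact g ∧ AlgebraicGeometry.IsIntegral S ∧ Literature.AlgebraicGeometry.Resolution.Scheme.IsRegular S ∧ AlgebraicGeometry.IsIntegral X' ∧ AlgebraicGeometry.IsFinite π ∧ ∀ x : X', IsClosed ({x} : Set X') → ∀ P ∈ minimalPrimes (AdicCompletion (IsLocalRing.maximalIdeal (X'.presheaf.stalk x)) (X'.presheaf.stalk x)), ∃ (d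 g : ℕ) (n : Fin g → ℕ) (v : Fin g → (Fin d → ℚ)) (c : Fin g → k) (A : Fin g → (Fin d →₀ ℕ)) (mu : Fin g → (Fin g →₀ ℕ)) (h : Fin g → MvPolynomial (Fin g) (MvPowerSeries (Fin d) k)) (φ : AdicCompletion (IsLocalRing.maximalIdeal (S.presheaf.stalk (π.base x))) (S.presheaf.stalk (π.base x)) ≃+* MvPowerSeries (Fin d) k), let W : (Fin d →₀ ℕ) → (Fin g →₀ ℕ) → (Fin d → ℚ) := fun a e j => (a j : ℚ) + ∑ i : Fin g, (e i : ℚ) * v i j; let core : Fin g → MvPolynomial (Fin g) (MvPowerSeries (Fin d) k) := fun i => MvPolynomial.X i ^ (n i) - MvPolynomial.C (MvPowerSeries.monomial (A i) (c i)) * MvPolynomial.monomial (mu i) 1 + h i; let E : Fin g → MvPolynomial (Fin g) (MvPowerSeries (Fin d) k) := fun i => if hi : i.val + 1 < g then MvPolynomial.X ⟨i.val + 1, hi⟩ - core i else core i; let B : Fin g → MvPolynomial (Fin d ⊕ Fin g) k := fun i => MvPolynomial.X (Sum.inr i) ^ (n i) - MvPolynomial.C (c i) * MvPolynomial.monomial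 ((A i).sumElim (mu i)) 1; ∃ ψ : (AdicCompletion (IsLocalRing.maximalIdeal (X'.presheaf.stalk x)) (X'.presheaf.stalk x) ⧸ P) ≃+* (MvPolynomial (Fin g) (MvPowerSeries (Fin d) k) ⧸ Ideal.span (Set.range E)), (∀ i, 2 ≤ n i) ∧ (∀ i, c i ≠ 0) ∧ (∀ i j, 0 ≤ v i j) ∧ (∀ i (j : Fin g), i.val ≤ j.val → mu i j = 0) ∧ (∀ i, n i • v i = W (A i) (mu i)) ∧ (∀ (i : Fin g) (hi : i.val + 1 < g), n i • v i ≤ v ⟨i.val + 1, hi⟩ ∧ n i • v i ≠ v ⟨i.val + 1, hi⟩) ∧ (∀ i, ∀ e ∈ (h i).support, (∀ j : Fin g, i.val + 1 < j.val → e j = 0) ∧ ∀ a : Fin d →₀ ℕ, MvPowerSeries.coeff a ((h i).coeff e) ≠ 0 → n i • v i ≤ W a e ∧ n i • v i ≠ W a e) ∧ (Ideal.span (Set.range B)).IsPrime ∧ (∀ a : S.presheaf.stalk (π.base x), ψ (Ideal.Quotient.mk P (algebraMap _ _ ((π.stalkMap x).hom a))) = Ideal.Quotient.mk _ (MvPolynomial.C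 (φ (algebraMap _ _ a))))); ∀ X' : AlgebraicGeometry.Scheme.{0}, TF X' → Literature.AlgebraicGeometry.Resolution.Scheme.HasResolution X'

/-- item stmt-ResolutionOfSingularities-15964 · crux · rank 4 · closed · proved by Summit.ResolutionOfSingularities.ResolutionOfSingularities.Theorems.HypersurfacesSuffice.HypersurfacesSuffice_of @ 95b3a1a99729 (prover) · by planner
why it might fail: only if mis-typed: classical (Hartshorne I.4.9 generic projection + normalisation transfer + CossartPiltant2019 Prop 4.6); birationality of a generic linear projection needs k(X)/k separably generated — true for k perfect.
sources: Hartshorne1977, Kollar2007, CossartPiltant2019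
[crux] HYPERSURFACES SUFFICE (k algebraically closed, any characteristic): if every integral closed
H ⊆ P^m_k whose ideal is locally principal (a hypersurface) has a resolution of singularities, then
every reduced separated k-scheme of finite type has one. = (reduced ⇒ integral closed subschemes of
P^n: irreducible components with reduced structure, Chow's lemma, projective closure, transport
along open immersions / proper birational maps — IN TREE verbatim as
Theorems.WeightedThesis.ProjectiveIntegralSuffices.stub_projectiveIntegralSuffices,
CossartPiltant2019 Prop 4.6 Steps 1–3) + (integral closed X ⊆ P^n ⇒ hypersurface model: generic
linear projection X → P^{dim X+1}, finite and birational onto its closed image H since k(X)/k is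
separably generated (k perfect), Hartshorne1977 I.4.9; a resolution of H is regular hence normal, so
it factors through X, which is integral over H inside k(H) = k(X), and resolves X — tree:
WeightedThesis.FiniteBirationalTransfer landed, HypersurfaceModel{Image,Projection,FieldCore}
landing). Supersedes rev-1 HypersurfaceModels (stmt-ResolutionOfSingularities-16072) by composing it
with the dropped support ProjectiveIntegralSuffices (stmt-ResolutionOfSi -/
@[route_item "route-ResolutionOfSingularities-TeissierJung", crux]
def HypersurfacesSuffice : Prop :=
  ∀ (k : Type) [Field k] [IsAlgClosed k], (∀ (m : ℕ) (H : AlgebraicGeometry.Scheme.{0}) (ι' : H ⟶ (Literature.AlgebraicGeometry.Motives.projectiveSpace m k).left), AlgebraicGeometry.IsClosedImmersion ι' → AlgebraicGeometry.IsIntegral H → (∀ y : (Literature.AlgebraicGeometry.Motives.projectiveSpace m k).left, ∃ U : (Literature.AlgebraicGeometry.Motives.projectiveSpace m k).left.affineOpens, y ∈ (U : (Literature.AlgebraicGeometry.Motives.projectiveSpace m k).left.Opens) ∧ (ι'.ker.ideal U).IsPrincipal) → Literature.AlgebraicGeometry.Resolution.Scheme.HasResolution H) → ∀ (X : AlgebraicGeometry.Scheme.{0})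 (f : X ⟶ AlgebraicGeometry.Spec (.of k)), AlgebraicGeometry.IsSeparated f → AlgebraicGeometry.LocallyOfFiniteType f → AlgebraicGeometry.QuasiCompact f → AlgebraicGeometry.IsReduced X → Literature.AlgebraicGeometry.Resolution.Scheme.HasResolution X

/-- `HypersurfacesSuffice` holds: proved by `Summit.ResolutionOfSingularities.ResolutionOfSingularities.Theorems.HypersurfacesSuffice.HypersurfacesSuffice_of` @ 95b3a1a99729. -/
theorem HypersurfacesSuffice_holds : HypersurfacesSuffice := _root_.Summit.ResolutionOfSingularities.ResolutionOfSingularities.Theorems.HypersurfacesSuffice.HypersurfacesSuffice_of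

/-- item stmt-ResolutionOfSingularities-0550 · crux · rank 5 · open · by planner
why it might fail: print gets kbar ⇒ perfect k only for Galois-EQUIVARIANT resolutions (Kollar2007 Thm 3.36); from bare existence the Galois-symmetrised fibre product is singular; false if some X over F_q has no Gal-stable resolution.
sources: Kollar2007, Literature.Barriers.ResolutionOfSingularities.InseparableBaseChange
AlgClosedToPerfect: for a prime p, resolution of all reduced separated finite-type schemes over all
ALGEBRAICALLY CLOSED fields of char p implies the same over all PERFECT fields of char p. Needs
Galois descent of some resolution (a Gal-invariant one), i.e. a canonicity input, or a trick
avoiding it. -/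
@[route_item "route-ResolutionOfSingularities-TeissierJung", crux]
def DescentAlgclosedToPerfect : Prop :=
  ∀ p : ℕ, p.Prime → (∀ (k : Type) [Field k] [CharP k p] [IsAlgClosed k] (X : AlgebraicGeometry.Scheme.{0}) (f : X ⟶ AlgebraicGeometry.Spec (.of k)), AlgebraicGeometry.IsSeparated f → AlgebraicGeometry.LocallyOfFiniteType f → AlgebraicGeometry.QuasiCompact f → AlgebraicGeometry.IsReduced X → Literature.AlgebraicGeometry.Resolution.Scheme.HasResolution X) → ∀ (k : Type) [Field k] [CharP k p] [PerfectField k] (X : AlgebraicGeometry.Scheme.{0}) (f : X ⟶ AlgebraicGeometry.Spec (.of k)), AlgebraicGeometry.IsSeparated f → AlgebraicGeometry.LocallyOfFiniteType f → AlgebraicGeometry.QuasiCompact f → AlgebraicGeometry.IsReduced X → Literature.AlgebraicGeometry.Resolution.Scheme.HasResolution X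

/-- item stmt-ResolutionOfSingularities-0549 · crux · rank 6 · open · by planner
why it might fail: regular is not geometrically regular under inseparable ground-field extension (EGA IV 6.7.4); spreading out needs k/K0 separable, impossible beyond the p-rank (MacLane; k = F_p((t))).
sources: arXiv:math/0703678, CossartPiltant2019, Literature.Barriers.ResolutionOfSingularities.InseparableBaseChange
PerfectToAll: for a prime p, resolution of all reduced separated finite-type schemes over all
PERFECT fields of char p implies ResolutionInChar p (all fields of char p). Expected inputs:
Neron-Popescu (Stacks 07GC), spreading out, openness of regular locus on excellent schemes;
regularity is not stable under inseparable ground field extension, which is the difficulty. -/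
@[route_item "route-ResolutionOfSingularities-TeissierJung", crux]
def DescentPerfectToAll : Prop :=
  ∀ p : ℕ, p.Prime → (∀ (k : Type) [Field k] [CharP k p] [PerfectField k] (X : AlgebraicGeometry.Scheme.{0}) (f : X ⟶ AlgebraicGeometry.Spec (.of k)), AlgebraicGeometry.IsSeparated f → AlgebraicGeometry.LocallyOfFiniteType f → AlgebraicGeometry.QuasiCompact f → AlgebraicGeometry.IsReduced X → Literature.AlgebraicGeometry.Resolution.Scheme.HasResolution X) → Literature.AlgebraicGeometry.Resolution.ResolutionInChar.{0} p

/-- item stmt-ResolutionOfSingularities-17087 · assembly · rank 1 · open · by planner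
sources: MourtadaSchober2025, Kollar2007
[assembly] TeissierReduction → TeissierResolve → HypersurfacesSuffice → DescentAlgclosedToPerfect →
DescentPerfectToAll → ResolutionOfSingularities. -/
@[route_item "route-ResolutionOfSingularities-TeissierJung"]
def Assembly : Prop :=
  TeissierReduction → TeissierResolve → HypersurfacesSuffice → DescentAlgclosedToPerfect → DescentPerfectToAll → _root_.ResolutionOfSingularities

/-! D-0027 §2.1 — DECIDING THEOREM (planner-authored via `route open/edit --closes-file`; by planner-plan-novel-ResolutionOfSingularities-Re-dc19aa3a-a-v 2026-08-17T01:10:19Z):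
its hypotheses are this route's items and its conclusion the sub-problem Statement (glue_lint), and it elaborates with this file. -/

@[closes "route-ResolutionOfSingularities-TeissierJung"] theorem closes (hR : TeissierReduction) (hT : TeissierResolve) (hHS : HypersurfacesSuffice)
    (hAlg : DescentAlgclosedToPerfect) (hPerf : DescentPerfectToAll) :
    _root_.ResolutionOfSingularities := by
  classical
  refine _root_.ResolutionOfSingularities_iff.mpr fun p hp => hPerf p hp (hAlg p hp
    fun k _ _ _ X f h1 h2 h3 h4 => hHS k ?_ X f h1 h2 h3 h4)
  intro m H ι' hι' hH hprinc
  obtain ⟨X', ρ, hρp, hρb, hdata⟩ := hR p hp k m H ι' hι' hH hprinc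
  haveI := hρp
  exact Literature.AlgebraicGeometry.Resolution.ComponentGluing.Scheme.HasResolution.of_isBirational
    ρ hρb (hT p hp k X' hdata)

end Summit.ResolutionOfSingularities.ResolutionOfSingularities.Theses.TeissierJung
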